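import Literature.AlgebraicGeometry.HodgeTheory.SmoothHypersurfaceBettiNumbersConstant
import Literature.AlgebraicGeometry.HodgeTheory.FermatEvenMiddleBettiNumber
import Literature.AlgebraicGeometry.HodgeTheory.FermatOddDegreeRestriction
import HarnessLib

/-!
# The middle Betti number of a smooth hypersurface of degree `d` in `ℙⁿ⁺¹`: `bₙ(X_F) = #𝔄ⁿ_d + 1` for `n` even, `bₙ(X_F) ≤ #𝔄ⁿ_d` for `n` odd,
# `𝔄ⁿ_d = {α ∈ (ℤ/d ∖ 0)ⁿ⁺² : Σ αᵢ = 0}` (Eisenbud–Harris 2016 Example 5.24 via Shioda's count at the Fermat variety)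

Family `hodge`, layer `Literature/AlgebraicGeometry/HodgeTheory`. PROOF FILE (theorems only: no definition, no named fact, no instance;
D-0026 net debt `0`). D. Eisenbud, J. Harris, *3264 and All That* (2016), §5.7 Example 5.24: the Betti numbers of a smooth hypersurface
of degree `d` in `ℙⁿ⁺¹` depend only on `(n, d)` ("`χ_top(X) = deg c_n(T_X) = Σ (−1)^i C(n+2, n−i) d^{i+1}`" and Lefschetz off the middle),
and T. Shioda, Math. Ann. 245 (1979) §1 (1.3)–(1.4): at the Fermat variety `Xⁿ_d` the primitive middle cohomology is `⊕_{α ∈ 𝔄ⁿ_d} V(α)`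
with `dim V(α) = 1`, so `bₙ(Xⁿ_d) = |𝔄ⁿ_d| + 1` for `n` even (`+1` = the class `h^{n/2}`) and `= |𝔄ⁿ_d|` for `n` odd. Combining the
tree's deformation constancy (`finrank_bettiCohomology_hypersurface_eq_of_isNonsingularForm`, Ehresmann on the universal smooth
hypersurface) with the Fermat counts (`finrank_complexBetti_fermat_even_eq_card_add_one`, PROVED with equality; `finrank_complexBetti_fermat_odd_le`,
the tree's upper bound in odd dimension):

* **`finrank_bettiCohomology_middle_hypersurface_even`** — `b₂ᵣ(X_F) = #{α ∈ (ℤ/d ∖ 0)^{2r+2} : Σ αᵢ = 0} + 1` for every nonsingular form `F`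
  of degree `d ≥ 1` in `2r + 2` variables, `r ≥ 1`, `d ≥ 1` as `[NeZero d]` (the general even-dimensional form of `EisenbudHarris2016_surface_secondBettiNumber`;
  closed form `((d−1)^{2r+2} + (d−1))/d + 1`, kept as a cardinal to avoid division).
* **`finrank_bettiCohomology_middle_hypersurface_odd_le`** — `b₂ᵣ₊₁(X_F) ≤ #{α ∈ (ℤ/d ∖ 0)^{2r+3} : Σ αᵢ = 0}` for every nonsingular form of
  degree `d ≥ 1` in `2r + 3` variables (equality is Shioda's theorem; the tree proves the non-vanishing half only in even dimension).

Written by the prover seat `hodge-nonav-prover-Bx` (g10).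
-- TODO(general form): equality in odd dimension (needs `V(α) ≠ 0` on odd-dimensional Fermat varieties), the closed-form polynomial.

## References

* [EisenbudHarris2016] D. Eisenbud, J. Harris, 3264 and All That, CUP 2016, §5.7 Example 5.24.
* [Shioda1979HodgeFermat] T. Shioda, The Hodge conjecture for Fermat varieties, Math. Ann. 245 (1979), §1 (1.3)–(1.4).
* [VoisinHodgeI2002] C. Voisin, Hodge Theory and Complex Algebraic Geometry I, CUP 2002, Thm. 9.3.
-/

noncomputable section

open CategoryTheory AlgebraicGeometry MvPolynomial

namespace Literature.AlgebraicGeometry.HodgeTheory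

open Literature.AlgebraicGeometry.Motives Literature.AlgebraicTopology.SingularHomology

variable {d : ℕ}

/-- `dim_ℚ Hᵏ(X(ℂ); ℚ) = dim_ℂ Hᵏ(X(ℂ); ℂ)` (universal coefficients; plumbing). [folklore] -/
private theorem finrank_rat_eq_complex (X : SchemeOver ℂ) (k : ℕ) :
    Module.finrank ℚ (bettiCohomology X k) = Module.finrank ℂ (complexBetti X k) := by
  change Module.finrank ℚ (singularCohomology ℚ ℚ (ComplexPoints X) k) =
    Module.finrank ℂ (singularCohomology ℂ ℂ (ComplexPoints X) k)
  rw [finrank_singularCohomology_eq_bettiNumber_of_field, finrank_singularCohomology_eq_bettiNumber_of_field,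
    bettiNumber_eq_of_algebra ℚ ℂ]

/-- **The middle Betti number of a smooth EVEN-dimensional hypersurface**: for a nonsingular form `F` of degree `d ≥ 1` in `2r + 2`
variables (`r ≥ 1`), `b₂ᵣ(X_F) = #{α ∈ (ℤ/d ∖ 0)^{2r+2} : Σ αᵢ = 0} + 1` — `b₂ᵣ` is constant over the universal family of smooth
hypersurfaces (Ehresmann) and this is its value at the Fermat variety `X²ʳ_d` (Shioda's character decomposition).
[cite: EisenbudHarris2016, Example 5.24] [cite: Shioda1979HodgeFermat, §1 (1.3)–(1.4)] [cite: VoisinHodgeI2002, Thm. 9.3] -/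
theorem finrank_bettiCohomology_middle_hypersurface_even [NeZero d] {r : ℕ} (hr : 1 ≤ r)
    (F : MvPolynomial (Fin (2 * r + 2)) ℂ) (hF : F.IsHomogeneous d) (hFns : SmoothHypersurface.IsNonsingularForm ℂ F) :
    Module.finrank ℚ (bettiCohomology (SmoothHypersurface.hypersurface F) (2 * r)) =
      Fintype.card {α : Fin (2 * r + 2) → ZMod d // (∀ i, α i ≠ 0) ∧ ∑ i, α i = 0} + 1 := by
  have hd : 1 ≤ d := NeZero.one_le
  have hfermat : SmoothHypersurface.IsNonsingularForm ℂ (fermatPolynomial ℂ (2 * r) d) :=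
    SmoothHypersurface.isNonsingularForm_sum_X_pow (Nat.cast_ne_zero.mpr (NeZero.ne d))
  rw [finrank_bettiCohomology_hypersurface_eq_of_isNonsingularForm (n := 2 * r) hd hF hFns
    (isHomogeneous_fermatPolynomial (2 * r) d) hfermat (2 * r), finrank_rat_eq_complex]
  exact finrank_complexBetti_fermat_even_eq_card_add_one hr

/-- **The middle Betti number of a smooth ODD-dimensional hypersurface is at most the number of admissible characters**: for a
nonsingular form `F` of degree `d ≥ 1` in `2r + 3` variables, `b₂ᵣ₊₁(X_F) ≤ #{α ∈ (ℤ/d ∖ 0)^{2r+3} : Σ αᵢ = 0}` (Ehresmann constancy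
and the tree's upper bound at the Fermat variety `X²ʳ⁺¹_d`). [cite: EisenbudHarris2016, Example 5.24] [cite: Shioda1979HodgeFermat, §1 (1.3)–(1.4)] -/
theorem finrank_bettiCohomology_middle_hypersurface_odd_le [NeZero d] (r : ℕ)
    (F : MvPolynomial (Fin (2 * r + 1 + 2)) ℂ) (hF : F.IsHomogeneous d) (hFns : SmoothHypersurface.IsNonsingularForm ℂ F) :
    Module.finrank ℚ (bettiCohomology (SmoothHypersurface.hypersurface F) (2 * r + 1)) ≤
      Fintype.card {α : Fin (2 * r + 3) → ZMod d // (∀ i, α i ≠ 0) ∧ ∑ i, α i = 0} := by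
  have hd : 1 ≤ d := NeZero.one_le
  have hfermat : SmoothHypersurface.IsNonsingularForm ℂ (fermatPolynomial ℂ (2 * r + 1) d) :=
    SmoothHypersurface.isNonsingularForm_sum_X_pow (Nat.cast_ne_zero.mpr (NeZero.ne d))
  rw [finrank_bettiCohomology_hypersurface_eq_of_isNonsingularForm (n := 2 * r + 1) hd hF hFns
    (isHomogeneous_fermatPolynomial (2 * r + 1) d) hfermat (2 * r + 1), finrank_rat_eq_complex]
  exact finrank_complexBetti_fermat_odd_le (m := d) r

end Literature.AlgebraicGeometry.HodgeTheory

end
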